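import Mathlib
import HarnessLib

/-!
# De Lellis–Otto–Westdickenberg, Prop. 3.2: an inequality on averages of functions

Topic `Literature/Analysis/PDE/SingleEntropy` — ingredients of the formalization of
De Lellis–Otto–Westdickenberg, *Minimal entropy conditions for Burgers equation*, Quart. Appl.
Math. 62 (2004) 687–700, Thm 2.3 / Cor 2.5 (the named fact
`Literature.Analysis.PDE.deLellisOttoWestdickenberg_singleEntropy`).

This file proves Proposition 3.2 (b)–(c) of the paper: for `f, η ∈ C²` with `f'' ≥ a ≥ 0`,
`η'' ≥ b ≥ 0` and entropy flux `q' = f' η'`, the bilinear form of (3.1)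
`B(f, η) = ⟨u q⟩ - ⟨η f⟩ + ⟨f⟩⟨η⟩ - ⟨u⟩⟨q⟩` over a probability law satisfies
`(a b / 24) ∬ (u - v)⁴ ≤ B(f, η)` (so `B ≥ 0` for convex `f, η`, and `B` controls a fourth
moment for uniformly convex `f, η`). Instead of the paper's reduction to Kruzhkov entropies we
average the pointwise kernel inequality
`(a b / 12)(u - v)⁴ ≤ (u - v)(q u - q v) - (η u - η v)(f u - f v)` (`dlow_kernel_ineq`), itself
proved by differentiating twice in `u`.

## References

* C. De Lellis, F. Otto, M. Westdickenberg, Quart. Appl. Math. 62 (2004) 687–700, Prop. 3.2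
  [DelellisOttoWestdickenberg2004].
-/

noncomputable section

open MeasureTheory Set

namespace Literature.Analysis.PDE.SingleEntropy


/-- Calculus lemma: a twice differentiable `F : ℝ → ℝ` with `F v = 0`, `F' v = 0` and `F'' ≥ 0`
everywhere is nonnegative (it is convex with a critical point at `v`). [folklore] -/
theorem nonneg_of_deriv_deriv_nonneg {F : ℝ → ℝ} {v : ℝ} (hF : Differentiable ℝ F)
    (hF' : Differentiable ℝ (deriv F)) (h0 : F v = 0) (h1 : deriv F v = 0)
    (h2 : ∀ w, 0 ≤ deriv (deriv F) w) (w : ℝ) : 0 ≤ F w := by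
  have hmono : Monotone (deriv F) := monotone_of_deriv_nonneg hF' h2
  rcases le_total v w with hvw | hwv
  · have hm : MonotoneOn F (Ici v) :=
      monotoneOn_of_deriv_nonneg (convex_Ici v) hF.continuous.continuousOn
        hF.differentiableOn (fun x hx => by
          rw [interior_Ici] at hx
          simpa [h1] using hmono (le_of_lt hx))
    simpa [h0] using hm self_mem_Ici hvw hvw
  · have hm : AntitoneOn F (Iic v) :=
      antitoneOn_of_deriv_nonpos (convex_Iic v) hF.continuous.continuousOn
        hF.differentiableOn (fun x hx => by
          rw [interior_Iic] at hx
          simpa [h1] using hmono (le_of_lt hx))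
    simpa [h0] using hm hwv self_mem_Iic hwv

/-- `C²` functions have a differentiable derivative. This is Mathlib's
`ContDiff.differentiable_deriv_two`; the name is kept for the uses below. [folklore] -/
theorem differentiable_deriv_of_contDiff_two {η : ℝ → ℝ} (hη : ContDiff ℝ 2 η) :
    Differentiable ℝ (deriv η) :=
  hη.differentiable_deriv_two

/-- Second-order lower Taylor bound: if `η ∈ C²` with `η'' ≥ b` then
`η u + η' u (v - u) + (b/2) (v - u)² ≤ η v`, written as
`(b/2)(u-v)² ≤ (u - v) η'(u) - (η u - η v)`. [folklore] -/
theorem sq_le_sub_mul_deriv_sub_of_le_deriv_deriv {η : ℝ → ℝ} {b : ℝ} (hη : ContDiff ℝ 2 η)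
    (hb : ∀ w, b ≤ deriv (deriv η) w) (u v : ℝ) :
    b / 2 * (u - v) ^ 2 ≤ (u - v) * deriv η u - (η u - η v) := by
  have hd1 : Differentiable ℝ η := hη.differentiable (by norm_num)
  have hd2 : Differentiable ℝ (deriv η) := differentiable_deriv_of_contDiff_two hη
  -- `Φ v' := η v' - η u - η' u (v' - u) - b/2 (v' - u)^2` is ≥ 0.
  have hΦd : ∀ v', HasDerivAt (fun v' => η v' - η u - deriv η u * (v' - u) - b / 2 * (v' - u) ^ 2)
      (deriv η v' - deriv η u - b * (v' - u)) v' := by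
    intro v'
    have h1 : HasDerivAt (fun v' => η v' - η u) (deriv η v') v' :=
      (hd1 v').hasDerivAt.sub_const _
    have h2 : HasDerivAt (fun v' => deriv η u * (v' - u)) (deriv η u * 1) v' :=
      ((hasDerivAt_id v').sub_const u).const_mul _
    have h3 : HasDerivAt (fun v' => b / 2 * (v' - u) ^ 2) (b / 2 * (2 * (v' - u) ^ 1 * 1)) v' :=
      (((hasDerivAt_id v').sub_const u).pow 2).const_mul _
    have h := (h1.sub h2).sub h3
    have he : deriv η v' - deriv η u * 1 - b / 2 * (2 * (v' - u) ^ 1 * 1)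
        = deriv η v' - deriv η u - b * (v' - u) := by ring
    rw [he] at h
    exact h
  have hΦ' : deriv (fun v' => η v' - η u - deriv η u * (v' - u) - b / 2 * (v' - u) ^ 2)
      = fun v' => deriv η v' - deriv η u - b * (v' - u) :=
    funext fun v' => (hΦd v').deriv
  have hΦdd : ∀ v', HasDerivAt (fun v' => deriv η v' - deriv η u - b * (v' - u))
      (deriv (deriv η) v' - b) v' := by
    intro v'
    have h1 : HasDerivAt (fun v' => deriv η v' - deriv η u) (deriv (deriv η) v') v' :=
      (hd2 v').hasDerivAt.sub_const _
    have h2 : HasDerivAt (fun v' => b * (v' - u)) (b * 1) v' :=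
      ((hasDerivAt_id v').sub_const u).const_mul _
    have h := h1.sub h2
    rw [mul_one] at h
    exact h
  have key := nonneg_of_deriv_deriv_nonneg
    (F := fun v' => η v' - η u - deriv η u * (v' - u) - b / 2 * (v' - u) ^ 2) (v := u)
    (fun v' => (hΦd v').differentiableAt)
    (by rw [hΦ']; exact fun v' => (hΦdd v').differentiableAt)
    (by simp) (by rw [hΦ']; simp)
    (fun w => by rw [hΦ', (hΦdd w).deriv]; linarith [hb w]) v
  nlinarith [key]

/-- **De Lellis–Otto–Westdickenberg, Prop. 3.2 (b)–(c), pointwise kernel.** For `f, η ∈ C²`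
with `f'' ≥ a ≥ 0`, `η'' ≥ b ≥ 0` and an entropy flux `q` (`q' = f' η'`), for all `u, v`:
`(a b / 12) (u - v)⁴ ≤ (u - v)(q u - q v) - (η u - η v)(f u - f v)`.
Averaging over `u, v` i.i.d. gives Prop. 3.2: the left side averages to a fourth-moment
quantity and the right side to twice the bilinear form `B(f, η)` of (3.1).
[cite: DelellisOttoWestdickenberg2004, Prop. 3.2] -/
theorem dlow_kernel_ineq {f η q : ℝ → ℝ} {a b : ℝ} (hf : ContDiff ℝ 2 f) (hη : ContDiff ℝ 2 η)
    (ha : 0 ≤ a) (hb : 0 ≤ b) (hfa : ∀ w, a ≤ deriv (deriv f) w)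
    (hηb : ∀ w, b ≤ deriv (deriv η) w) (hq : ∀ w, HasDerivAt q (deriv f w * deriv η w) w)
    (u v : ℝ) :
    a * b / 12 * (u - v) ^ 4 ≤ (u - v) * (q u - q v) - (η u - η v) * (f u - f v) := by
  have hfd1 : Differentiable ℝ f := hf.differentiable (by norm_num)
  have hfd2 : Differentiable ℝ (deriv f) := differentiable_deriv_of_contDiff_two hf
  have hηd1 : Differentiable ℝ η := hη.differentiable (by norm_num)
  have hηd2 : Differentiable ℝ (deriv η) := differentiable_deriv_of_contDiff_two hη
  -- F, its derivative F1 and second derivative F2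
  have hFd : ∀ u, HasDerivAt
      (fun u => (u - v) * (q u - q v) - (η u - η v) * (f u - f v) - a * b / 12 * (u - v) ^ 4)
      ((q u - q v) + (u - v) * (deriv f u * deriv η u)
        - deriv η u * (f u - f v) - (η u - η v) * deriv f u - a * b / 3 * (u - v) ^ 3) u := by
    intro u
    have h1 : HasDerivAt (fun u => (u - v) * (q u - q v))
        (1 * (q u - q v) + (u - v) * (deriv f u * deriv η u)) u :=
      ((hasDerivAt_id u).sub_const v).mul ((hq u).sub_const _)
    have h2 : HasDerivAt (fun u => (η u - η v) * (f u - f v))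
        (deriv η u * (f u - f v) + (η u - η v) * deriv f u) u :=
      ((hηd1 u).hasDerivAt.sub_const _).mul ((hfd1 u).hasDerivAt.sub_const _)
    have h3 : HasDerivAt (fun u => a * b / 12 * (u - v) ^ 4)
        (a * b / 12 * (4 * (u - v) ^ 3 * 1)) u :=
      (((hasDerivAt_id u).sub_const v).pow 4).const_mul _
    have h := (h1.sub h2).sub h3
    have he : 1 * (q u - q v) + (u - v) * (deriv f u * deriv η u)
        - (deriv η u * (f u - f v) + (η u - η v) * deriv f u) - a * b / 12 * (4 * (u - v) ^ 3 * 1)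
        = (q u - q v) + (u - v) * (deriv f u * deriv η u)
          - deriv η u * (f u - f v) - (η u - η v) * deriv f u - a * b / 3 * (u - v) ^ 3 := by
      ring
    rw [he] at h
    exact h
  have hF' : deriv
      (fun u => (u - v) * (q u - q v) - (η u - η v) * (f u - f v) - a * b / 12 * (u - v) ^ 4)
      = fun u => (q u - q v) + (u - v) * (deriv f u * deriv η u)
        - deriv η u * (f u - f v) - (η u - η v) * deriv f u - a * b / 3 * (u - v) ^ 3 :=
    funext fun u => (hFd u).deriv
  have hF1d : ∀ u, HasDerivAt
      (fun u => (q u - q v) + (u - v) * (deriv f u * deriv η u)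
        - deriv η u * (f u - f v) - (η u - η v) * deriv f u - a * b / 3 * (u - v) ^ 3)
      (deriv (deriv f) u * ((u - v) * deriv η u - (η u - η v))
        + deriv (deriv η) u * ((u - v) * deriv f u - (f u - f v)) - a * b * (u - v) ^ 2) u := by
    intro u
    have h1 : HasDerivAt (fun u => q u - q v) (deriv f u * deriv η u) u := (hq u).sub_const _
    have h2 : HasDerivAt (fun u => (u - v) * (deriv f u * deriv η u))
        (1 * (deriv f u * deriv η u)
          + (u - v) * (deriv (deriv f) u * deriv η u + deriv f u * deriv (deriv η) u)) u :=
      ((hasDerivAt_id u).sub_const v).mul ((hfd2 u).hasDerivAt.mul (hηd2 u).hasDerivAt)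
    have h3 : HasDerivAt (fun u => deriv η u * (f u - f v))
        (deriv (deriv η) u * (f u - f v) + deriv η u * deriv f u) u :=
      (hηd2 u).hasDerivAt.mul ((hfd1 u).hasDerivAt.sub_const _)
    have h4 : HasDerivAt (fun u => (η u - η v) * deriv f u)
        (deriv η u * deriv f u + (η u - η v) * deriv (deriv f) u) u :=
      ((hηd1 u).hasDerivAt.sub_const _).mul (hfd2 u).hasDerivAt
    have h5 : HasDerivAt (fun u => a * b / 3 * (u - v) ^ 3)
        (a * b / 3 * (3 * (u - v) ^ 2 * 1)) u :=
      (((hasDerivAt_id u).sub_const v).pow 3).const_mul _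
    have h := (((h1.add h2).sub h3).sub h4).sub h5
    have he : deriv f u * deriv η u + (1 * (deriv f u * deriv η u)
          + (u - v) * (deriv (deriv f) u * deriv η u + deriv f u * deriv (deriv η) u))
        - (deriv (deriv η) u * (f u - f v) + deriv η u * deriv f u)
        - (deriv η u * deriv f u + (η u - η v) * deriv (deriv f) u)
        - a * b / 3 * (3 * (u - v) ^ 2 * 1)
        = deriv (deriv f) u * ((u - v) * deriv η u - (η u - η v))
          + deriv (deriv η) u * ((u - v) * deriv f u - (f u - f v)) - a * b * (u - v) ^ 2 := by
      ring
    rw [he] at h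
    exact h
  have hF2nn : ∀ u, 0 ≤ deriv (deriv f) u * ((u - v) * deriv η u - (η u - η v))
      + deriv (deriv η) u * ((u - v) * deriv f u - (f u - f v)) - a * b * (u - v) ^ 2 := by
    intro u
    have hX := sq_le_sub_mul_deriv_sub_of_le_deriv_deriv hη hηb u v
    have hY := sq_le_sub_mul_deriv_sub_of_le_deriv_deriv hf hfa u v
    have hX0 : 0 ≤ (u - v) * deriv η u - (η u - η v) := le_trans (by positivity) hX
    have hY0 : 0 ≤ (u - v) * deriv f u - (f u - f v) := le_trans (by positivity) hY
    have h1 : a * ((u - v) * deriv η u - (η u - η v))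
        ≤ deriv (deriv f) u * ((u - v) * deriv η u - (η u - η v)) :=
      mul_le_mul_of_nonneg_right (hfa u) hX0
    have h2 : b * ((u - v) * deriv f u - (f u - f v))
        ≤ deriv (deriv η) u * ((u - v) * deriv f u - (f u - f v)) :=
      mul_le_mul_of_nonneg_right (hηb u) hY0
    have h3 : a * (b / 2 * (u - v) ^ 2) ≤ a * ((u - v) * deriv η u - (η u - η v)) :=
      mul_le_mul_of_nonneg_left hX ha
    have h4 : b * (a / 2 * (u - v) ^ 2) ≤ b * ((u - v) * deriv f u - (f u - f v)) :=
      mul_le_mul_of_nonneg_left hY hb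
    nlinarith [h1, h2, h3, h4]
  have key := nonneg_of_deriv_deriv_nonneg
    (F := fun u => (u - v) * (q u - q v) - (η u - η v) * (f u - f v) - a * b / 12 * (u - v) ^ 4)
    (v := v) (fun u => (hFd u).differentiableAt)
    (by rw [hF']; exact fun u => (hF1d u).differentiableAt)
    (by simp) (by rw [hF']; simp)
    (fun w => by rw [hF', (hF1d w).deriv]; exact hF2nn w) u
  linarith [key]

section Averages

variable {X : Type*} [MeasurableSpace X]

/-- A continuous function of a bounded measurable real function is integrable for a finite
measure. [folklore] -/
theorem integrable_comp_of_abs_le {P : Measure X} [IsFiniteMeasure P] {U : X → ℝ}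
    (hU : Measurable U) {M : ℝ} (hUM : ∀ x, |U x| ≤ M) {g : ℝ → ℝ} (hg : Continuous g) :
    Integrable (fun x => g (U x)) P := by
  obtain ⟨C, hC⟩ :=
    (isCompact_Icc (a := -M) (b := M)).exists_bound_of_continuousOn hg.continuousOn
  refine Integrable.of_bound (hg.measurable.comp hU).aestronglyMeasurable C
    (Filter.Eventually.of_forall fun x => hC _ ?_)
  exact mem_Icc.mpr (abs_le.mp (hUM x))

/-- A continuous function of two copies of a bounded measurable real function is integrable for
the product of a finite measure with itself. [folklore] -/
theorem integrable_prod_comp_of_abs_le {P : Measure X} [IsFiniteMeasure P] {U : X → ℝ}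
    (hU : Measurable U) {M : ℝ} (hUM : ∀ x, |U x| ≤ M) {G : ℝ × ℝ → ℝ} (hG : Continuous G) :
    Integrable (fun z : X × X => G (U z.1, U z.2)) (P.prod P) := by
  obtain ⟨C, hC⟩ := ((isCompact_Icc (a := -M) (b := M)).prod
    (isCompact_Icc (a := -M) (b := M))).exists_bound_of_continuousOn hG.continuousOn
  have hm : Measurable fun z : X × X => (U z.1, U z.2) :=
    (hU.comp measurable_fst).prodMk (hU.comp measurable_snd)
  refine Integrable.of_bound (hG.measurable.comp hm).aestronglyMeasurable C
    (Filter.Eventually.of_forall fun z => hC _ ?_)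
  exact mem_prod.mpr ⟨mem_Icc.mpr (abs_le.mp (hUM z.1)), mem_Icc.mpr (abs_le.mp (hUM z.2))⟩

/-- **De Lellis–Otto–Westdickenberg 2004, Prop. 3.2 (b)–(c)** (inequality on averages), for the
law of a bounded measurable `U` under a probability measure `P` (so `⟨g⟩ = ∫ g (U x) dP`):
with `B(f, η) := ⟨u q⟩ - ⟨η f⟩ + ⟨f⟩⟨η⟩ - ⟨u⟩⟨q⟩` (3.1), `f, η ∈ C²`, `f'' ≥ a ≥ 0`,
`η'' ≥ b ≥ 0`, `q' = f' η'`, one has `(a b / 24) ∬ (U x - U y)⁴ dP dP ≤ B(f, η)`; in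
particular `B ≥ 0` for convex `f, η` (part (b)), and since
`∬ (U x - U y)⁴ = 2⟨(u - ⟨u⟩)⁴⟩ + 6 Var(u)² ≥ 2⟨(u - ⟨u⟩)⁴⟩` this is the printed part (c)
`3 B(f, η) ≥ c² ⟨(u - ⟨u⟩)⁴⟩` when `f'', η'' ≥ 2c`. Proof: average the pointwise kernel
inequality `dlow_kernel_ineq` over `P ⊗ P`; the kernel averages to `2 B(f, η)`.
[cite: DelellisOttoWestdickenberg2004, Prop. 3.2] -/
theorem dlow_prop32_average (P : Measure X) [IsProbabilityMeasure P] {U : X → ℝ}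
    (hU : Measurable U) {M : ℝ} (hUM : ∀ x, |U x| ≤ M) {f η q : ℝ → ℝ} {a b : ℝ}
    (hf : ContDiff ℝ 2 f) (hη : ContDiff ℝ 2 η) (ha : 0 ≤ a) (hb : 0 ≤ b)
    (hfa : ∀ w, a ≤ deriv (deriv f) w) (hηb : ∀ w, b ≤ deriv (deriv η) w)
    (hq : ∀ w, HasDerivAt q (deriv f w * deriv η w) w) :
    a * b / 24 * ∫ x, ∫ y, (U x - U y) ^ 4 ∂P ∂P ≤
      (∫ x, U x * q (U x) ∂P) - (∫ x, η (U x) * f (U x) ∂P)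
        + (∫ x, f (U x) ∂P) * (∫ x, η (U x) ∂P) - (∫ x, U x ∂P) * (∫ x, q (U x) ∂P) := by
  have hqc : Continuous q := continuous_iff_continuousAt.2 fun w => (hq w).continuousAt
  have hfc : Continuous f := hf.continuous
  have hηc : Continuous η := hη.continuous
  have hKi : Integrable (fun z : X × X => (U z.1 - U z.2) * (q (U z.1) - q (U z.2))
      - (η (U z.1) - η (U z.2)) * (f (U z.1) - f (U z.2))) (P.prod P) :=
    integrable_prod_comp_of_abs_le hU hUM
      (G := fun p => (p.1 - p.2) * (q p.1 - q p.2) - (η p.1 - η p.2) * (f p.1 - f p.2))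
      (by fun_prop)
  have h4i : Integrable (fun z : X × X => (U z.1 - U z.2) ^ 4) (P.prod P) :=
    integrable_prod_comp_of_abs_le hU hUM (G := fun p => (p.1 - p.2) ^ 4) (by fun_prop)
  have h1 : ∫ x, ∫ y, (U x - U y) ^ 4 ∂P ∂P = ∫ z, (U z.1 - U z.2) ^ 4 ∂(P.prod P) :=
    (integral_prod _ h4i).symm
  have h2 : ∫ z, a * b / 12 * (U z.1 - U z.2) ^ 4 ∂(P.prod P)
      ≤ ∫ z, ((U z.1 - U z.2) * (q (U z.1) - q (U z.2))
          - (η (U z.1) - η (U z.2)) * (f (U z.1) - f (U z.2))) ∂(P.prod P) :=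
    integral_mono (h4i.const_mul _) hKi fun z => dlow_kernel_ineq hf hη ha hb hfa hηb hq _ _
  rw [integral_const_mul] at h2
  -- the eight pieces of the kernel
  have i1 : Integrable (fun z : X × X => U z.1 * q (U z.1)) (P.prod P) :=
    integrable_prod_comp_of_abs_le hU hUM (G := fun p => p.1 * q p.1) (by fun_prop)
  have i2 : Integrable (fun z : X × X => U z.1 * q (U z.2)) (P.prod P) :=
    integrable_prod_comp_of_abs_le hU hUM (G := fun p => p.1 * q p.2) (by fun_prop)
  have i3 : Integrable (fun z : X × X => q (U z.1) * U z.2) (P.prod P) :=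
    integrable_prod_comp_of_abs_le hU hUM (G := fun p => q p.1 * p.2) (by fun_prop)
  have i4 : Integrable (fun z : X × X => U z.2 * q (U z.2)) (P.prod P) :=
    integrable_prod_comp_of_abs_le hU hUM (G := fun p => p.2 * q p.2) (by fun_prop)
  have i5 : Integrable (fun z : X × X => η (U z.1) * f (U z.1)) (P.prod P) :=
    integrable_prod_comp_of_abs_le hU hUM (G := fun p => η p.1 * f p.1) (by fun_prop)
  have i6 : Integrable (fun z : X × X => η (U z.1) * f (U z.2)) (P.prod P) :=
    integrable_prod_comp_of_abs_le hU hUM (G := fun p => η p.1 * f p.2) (by fun_prop)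
  have i7 : Integrable (fun z : X × X => f (U z.1) * η (U z.2)) (P.prod P) :=
    integrable_prod_comp_of_abs_le hU hUM (G := fun p => f p.1 * η p.2) (by fun_prop)
  have i8 : Integrable (fun z : X × X => η (U z.2) * f (U z.2)) (P.prod P) :=
    integrable_prod_comp_of_abs_le hU hUM (G := fun p => η p.2 * f p.2) (by fun_prop)
  have e : ∫ z, ((U z.1 - U z.2) * (q (U z.1) - q (U z.2))
          - (η (U z.1) - η (U z.2)) * (f (U z.1) - f (U z.2))) ∂(P.prod P)
      = ∫ z, (U z.1 * q (U z.1) - U z.1 * q (U z.2) - q (U z.1) * U z.2 + U z.2 * q (U z.2)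
          - η (U z.1) * f (U z.1) + η (U z.1) * f (U z.2) + f (U z.1) * η (U z.2)
          - η (U z.2) * f (U z.2)) ∂(P.prod P) := by
    congr 1
    funext z
    ring
  have split : ∫ z, (U z.1 * q (U z.1) - U z.1 * q (U z.2) - q (U z.1) * U z.2 + U z.2 * q (U z.2)
          - η (U z.1) * f (U z.1) + η (U z.1) * f (U z.2) + f (U z.1) * η (U z.2)
          - η (U z.2) * f (U z.2)) ∂(P.prod P)
      = (∫ z, U z.1 * q (U z.1) ∂(P.prod P)) - (∫ z, U z.1 * q (U z.2) ∂(P.prod P))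
        - (∫ z, q (U z.1) * U z.2 ∂(P.prod P)) + (∫ z, U z.2 * q (U z.2) ∂(P.prod P))
        - (∫ z, η (U z.1) * f (U z.1) ∂(P.prod P)) + (∫ z, η (U z.1) * f (U z.2) ∂(P.prod P))
        + (∫ z, f (U z.1) * η (U z.2) ∂(P.prod P)) - (∫ z, η (U z.2) * f (U z.2) ∂(P.prod P)) := by
    rw [integral_sub, integral_add, integral_add, integral_sub, integral_add, integral_sub,
      integral_sub]
    all_goals fun_prop
  -- evaluate the eight pieces
  have j1 : ∫ z, U z.1 * q (U z.1) ∂(P.prod P) = ∫ x, U x * q (U x) ∂P := by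
    rw [integral_prod _ i1]
    simp
  have j4 : ∫ z, U z.2 * q (U z.2) ∂(P.prod P) = ∫ x, U x * q (U x) ∂P := by
    rw [integral_prod _ i4]
    simp
  have j5 : ∫ z, η (U z.1) * f (U z.1) ∂(P.prod P) = ∫ x, η (U x) * f (U x) ∂P := by
    rw [integral_prod _ i5]
    simp
  have j8 : ∫ z, η (U z.2) * f (U z.2) ∂(P.prod P) = ∫ x, η (U x) * f (U x) ∂P := by
    rw [integral_prod _ i8]
    simp
  have j2 : ∫ z, U z.1 * q (U z.2) ∂(P.prod P) = (∫ x, U x ∂P) * (∫ x, q (U x) ∂P) :=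
    integral_prod_mul (μ := P) (ν := P) U (fun y => q (U y))
  have j3 : ∫ z, q (U z.1) * U z.2 ∂(P.prod P) = (∫ x, q (U x) ∂P) * (∫ x, U x ∂P) :=
    integral_prod_mul (μ := P) (ν := P) (fun x => q (U x)) U
  have j6 : ∫ z, η (U z.1) * f (U z.2) ∂(P.prod P) = (∫ x, η (U x) ∂P) * (∫ x, f (U x) ∂P) :=
    integral_prod_mul (μ := P) (ν := P) (fun x => η (U x)) (fun y => f (U y))
  have j7 : ∫ z, f (U z.1) * η (U z.2) ∂(P.prod P) = (∫ x, f (U x) ∂P) * (∫ x, η (U x) ∂P) :=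
    integral_prod_mul (μ := P) (ν := P) (fun x => f (U x)) (fun y => η (U y))
  rw [e, split, j1, j2, j3, j4, j5, j6, j7, j8] at h2
  rw [h1]
  nlinarith [h2]

end Averages

end Literature.Analysis.PDE.SingleEntropy
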